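import Summits.MatrixMultiplication.MatrixMultiplication.Theorems.FarEdgeDescentGaloisGeneric
import Mathlib.FieldTheory.Minpoly.IsConjRoot
import Mathlib.FieldTheory.Perfect
import Mathlib.RingTheory.Polynomial.Cyclotomic.Roots
import HarnessLib

/-!
# Galois orbits on the BCZ line: conjugate moduli are equivalent, special moduli have bounded degree

Route `FarEdgeDescent` (cell `decomp-mm`, lens 2 «structural dichotomy (special vs generic)»,
gen 38), Kernel XIII-b; support for the aside `SubLogRate` (stmt-MatrixMultiplication-25371).

Kernel XIII-a (`FarEdgeDescentGaloisGeneric`) showed that `Aut(ℂ)` acts on the line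
`q ↦ 𝔖(q) = fam ℂ q` through the modulus with `R̃` invariant, that it is transitive on the
transcendental moduli, and hence that the special moduli are algebraic.  This file treats the
ALGEBRAIC moduli by the method of Heintz–Sieveking (BCS §9.2: a Zariski-closed `Aut(K/k)`-stable
finite set containing an algebraic point contains its whole orbit, whose size is the degree of the
point — there a lower bound for the complexity of polynomials with algebraic coefficients):

* §1: **`Aut(ℂ)` maps an algebraic number to each of its conjugates**
  (`exists_ringEquiv_apply_eq_of_isConjRoot`): `ℚ(a) ≃ ℚ(b)` by the power bases, transcendence
  bases of `ℂ` over `ℚ(a)` and over `ℚ(b)` are equipotent with `ℂ`, and the isomorphism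
  `ℚ(a)[X_s] ≃ ℚ(b)[X_t]` extends to the algebraic closures `ℂ ≃ ℂ` (`IsAlgClosure.equivOfEquiv`).
* §2: hence **conjugate moduli give the same asymptotic rank**
  (`asymptoticRank_fam_eq_of_isConjRoot`: `R̃(𝔖(b)) = R̃(𝔖(a))` whenever `b` is a root of the
  minimal polynomial of `a` over `ℚ`); every sublevel set `{q | R̃(𝔖(q)) ≤ r}` is a union of full
  `Gal(ℚ̄/ℚ)`-orbits (`rootSet_minpoly_subset_level`); and the Heintz–Sieveking count: **a special
  modulus has degree at most the size of its (finite) sublevel set**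
  (`natDegree_minpoly_le_ncard`: `R̃(𝔖(a)) ≤ c < R̃(𝔖(q₁))` ⟹ `[ℚ(a):ℚ] ≤ #{q | R̃(𝔖(q)) ≤ c}`),
  i.e. **below every level `c` short of the generic value only finitely many algebraic numbers
  of BOUNDED DEGREE are special; every modulus that is transcendental or algebraic of larger
  degree has `R̃(𝔖(q)) > c`** (`lt_asymptoticRank_fam_of_ncard_lt_natDegree`,
  `exists_degree_threshold`, `generic_of_transcendental_or_large_degree`).  With
  `q ↦ q⁻¹` (Kernel IX-c) and `q ↦ q̄` this exhausts the symmetries of the special set known to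
  the tree: it is a subset of `ℚ̄`, finite below each level, closed under `Gal(ℚ̄/ℚ)` and inversion.
* §3: roots of unity — **all `φ(n)` primitive `n`-th roots of unity give ONE value**
  `R̃(𝔖(e^{2πik/n}))` (`asymptoticRank_fam_eq_of_isPrimitiveRoot`, `asymptoticRank_fam_exp_pow`),
  a special root of unity has `φ(n) ≤ #{q | R̃(𝔖(q)) ≤ c}` (`totient_le_ncard_of_level_le`), and
  **roots of unity of large (e.g. prime `p > #{…} + 1`) order are generic below `c`**
  (`lt_asymptoticRank_fam_of_isPrimitiveRoot`, `lt_asymptoticRank_fam_exp_of_prime`): next to the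
  transcendental Liouville modulus of XIII-a, a named ALGEBRAIC family generic below every level.
* Not proved: that any algebraic `q ≠ 0` IS special (no member of the line other than `q = 0`
  is known to lie strictly below the generic value), nor any bound on `ω`.

References: P. Bürgisser, M. Clausen, M. A. Shokrollahi, *Algebraic Complexity Theory*,
Grundlehren 315, Springer 1997, §9.2, Lemma (9.12)(2) (orbit of an algebraic point under
`Aut(K/k)` has `[k(α):k]_s` elements), Thm. (9.13), Thm. (9.15) (Heintz–Sieveking)
[BurgisserClausenShokrollahi1997]; J. Heintz, M. Sieveking, *Lower bounds for polynomials with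
algebraic coefficients*, Theoret. Comput. Sci. 11 (1980) 321–330; M. Christandl, K. Hoeberechts,
H. Nieuwboer, P. Vrana, J. Zuiddam, arXiv:2411.15789, Thm. 1.2
[ChristandlHoeberechtsNieuwboerVranaZuiddam2025].
-/

noncomputable section

open scoped BigOperators Cardinal IntermediateField

set_option linter.dupNamespace false

namespace Summit.MatrixMultiplication.MatrixMultiplication.Theorems.FarEdgeDescentGaloisOrbit

open Literature.Computability.AlgebraicComplexity
open Summit.MatrixMultiplication.MatrixMultiplication.Theorems.FarEdgeDescentSignTwist
open Summit.MatrixMultiplication.MatrixMultiplication.Theorems.FarEdgeDescentSignTwistDet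
open Summit.MatrixMultiplication.MatrixMultiplication.Theorems.FarEdgeDescentWeightFamily
open Summit.MatrixMultiplication.MatrixMultiplication.Theorems.FarEdgeDescentSupportStratumDoor
open Summit.MatrixMultiplication.MatrixMultiplication.Theorems.FarEdgeDescentGenericDomination
open Summit.MatrixMultiplication.MatrixMultiplication.Theorems.FarEdgeDescentGaloisGeneric

/-! ## 1. `Aut(ℂ)` is transitive on each `Gal(ℚ̄/ℚ)`-orbit -/

section Transitive

open Cardinal IsAlgClosed IntermediateField

/-- `ℚ(a)` is countable for `a` algebraic. [folklore] -/
theorem mk_adjoin_simple_le_aleph0 {a : ℂ} (ha : IsIntegral ℚ a) : #ℚ⟮a⟯ ≤ ℵ₀ := by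
  haveI := adjoin.finiteDimensional ha
  haveI : Algebra.IsAlgebraic ℚ ℚ⟮a⟯ := Algebra.IsAlgebraic.of_finite ℚ _
  exact (Algebra.IsAlgebraic.cardinalMk_le_max ℚ ℚ⟮a⟯).trans (by simp)

/-- A transcendence basis of `ℂ` over `ℚ(a)`, `a` algebraic, is equipotent with `ℂ`. [folklore] -/
theorem mk_eq_of_isTranscendenceBasis_adjoin {a : ℂ} (ha : IsIntegral ℚ a) {s : Set ℂ}
    (hs : IsTranscendenceBasis ℚ⟮a⟯ ((↑) : s → ℂ)) : #s = #ℂ :=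
  (cardinal_eq_cardinal_transcendence_basis_of_aleph0_lt' _ hs (mk_adjoin_simple_le_aleph0 ha)
    aleph0_lt_mk_complex).symm

/-- **`Aut(ℂ)` maps an algebraic number to each of its conjugates**: if `b` is a root of the
minimal polynomial of `a` over `ℚ`, some field automorphism `σ` of `ℂ` has `σ a = b`
(`ℚ(a) ≃ ℚ(b)` extended through equipotent transcendence bases to the algebraic closure `ℂ`).
[cite: BurgisserClausenShokrollahi1997, §9.2 Lemma (9.12)] -/
theorem exists_ringEquiv_apply_eq_of_isConjRoot {a b : ℂ} (ha : IsIntegral ℚ a)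
    (hab : IsConjRoot ℚ a b) : ∃ σ : ℂ ≃+* ℂ, σ a = b := by
  classical
  have hb : IsIntegral ℚ b := IsConjRoot.isIntegral ha hab
  -- `ψ : ℚ(a) ≃ ℚ(b)` with `ψ a = b` (power bases with the same minimal polynomial)
  obtain ⟨ψ, hψ⟩ : ∃ ψ : ℚ⟮a⟯ ≃+* ℚ⟮b⟯, ψ (AdjoinSimple.gen ℚ a) = AdjoinSimple.gen ℚ b := by
    have hmin : minpoly ℚ a = minpoly ℚ b := hab
    rw [← minpoly_gen ℚ a, ← minpoly_gen ℚ b, ← adjoin.powerBasis_gen ha,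
      ← adjoin.powerBasis_gen hb] at hmin
    exact ⟨((adjoin.powerBasis ha).equivOfMinpoly (adjoin.powerBasis hb) hmin).toRingEquiv,
      by simpa using (adjoin.powerBasis ha).equivOfMinpoly_gen (adjoin.powerBasis hb) hmin⟩
  -- transcendence bases over `ℚ(a)` and `ℚ(b)`
  haveI : FaithfulSMul ℚ⟮a⟯ ℂ :=
    (faithfulSMul_iff_algebraMap_injective _ _).2 (algebraMap ℚ⟮a⟯ ℂ).injective
  haveI : FaithfulSMul ℚ⟮b⟯ ℂ :=
    (faithfulSMul_iff_algebraMap_injective _ _).2 (algebraMap ℚ⟮b⟯ ℂ).injective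
  obtain ⟨s, hs⟩ := exists_isTranscendenceBasis ℚ⟮a⟯ ℂ
  obtain ⟨t, ht⟩ := exists_isTranscendenceBasis ℚ⟮b⟯ ℂ
  obtain ⟨e⟩ := Cardinal.eq.1 ((mk_eq_of_isTranscendenceBasis_adjoin ha hs).trans
    (mk_eq_of_isTranscendenceBasis_adjoin hb ht).symm)
  letI := isAlgClosure_of_transcendence_basis ((↑) : s → ℂ) hs
  letI := isAlgClosure_of_transcendence_basis ((↑) : t → ℂ) ht
  -- `ℚ(a)[s] ≃ ℚ(a)[X_s] ≃ ℚ(b)[X_s] ≃ ℚ(b)[X_t] ≃ ℚ(b)[t]`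
  let μ : MvPolynomial s ℚ⟮a⟯ ≃+* MvPolynomial t ℚ⟮b⟯ :=
    (MvPolynomial.mapEquiv s ψ).trans (MvPolynomial.renameEquiv ℚ⟮b⟯ e).toRingEquiv
  have hμ : μ (MvPolynomial.C (AdjoinSimple.gen ℚ a)) = MvPolynomial.C (AdjoinSimple.gen ℚ b) := by
    simp [μ, MvPolynomial.map_C, ← hψ]
  let φ : Algebra.adjoin ℚ⟮a⟯ (Set.range ((↑) : s → ℂ)) ≃+*
      Algebra.adjoin ℚ⟮b⟯ (Set.range ((↑) : t → ℂ)) :=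
    hs.1.aevalEquiv.symm.toRingEquiv.trans (μ.trans ht.1.aevalEquiv.toRingEquiv)
  have h1 : hs.1.aevalEquiv.symm (algebraMap ℚ⟮a⟯ _ (AdjoinSimple.gen ℚ a)) =
      MvPolynomial.C (AdjoinSimple.gen ℚ a) := by
    rw [AlgEquiv.commutes, MvPolynomial.algebraMap_eq]
  have h2 : φ (algebraMap ℚ⟮a⟯ _ (AdjoinSimple.gen ℚ a)) =
      ht.1.aevalEquiv (MvPolynomial.C (AdjoinSimple.gen ℚ b)) := by
    show ht.1.aevalEquiv (μ (hs.1.aevalEquiv.symm _)) = _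
    rw [h1, hμ]
  have h0 : algebraMap (Algebra.adjoin ℚ⟮a⟯ (Set.range ((↑) : s → ℂ))) ℂ
      (algebraMap ℚ⟮a⟯ _ (AdjoinSimple.gen ℚ a)) = a := rfl
  refine ⟨IsAlgClosure.equivOfEquiv ℂ ℂ φ, ?_⟩
  calc IsAlgClosure.equivOfEquiv ℂ ℂ φ a
      = IsAlgClosure.equivOfEquiv ℂ ℂ φ (algebraMap (Algebra.adjoin ℚ⟮a⟯ (Set.range
          ((↑) : s → ℂ))) ℂ (algebraMap ℚ⟮a⟯ _ (AdjoinSimple.gen ℚ a))) := by rw [h0]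
    _ = algebraMap (Algebra.adjoin ℚ⟮b⟯ (Set.range ((↑) : t → ℂ))) ℂ
          (φ (algebraMap ℚ⟮a⟯ _ (AdjoinSimple.gen ℚ a))) :=
        IsAlgClosure.equivOfEquiv_algebraMap ℂ ℂ φ _
    _ = b := by
        rw [h2, ht.1.algebraMap_aevalEquiv, MvPolynomial.algHom_C, AdjoinSimple.algebraMap_gen]

end Transitive

/-! ## 2. Conjugate moduli, Galois-closed level sets, bounded degree of special moduli -/

section Orbit

/-- **Conjugate moduli give the same asymptotic rank: `R̃(𝔖(b)) = R̃(𝔖(a))`** for `b` a root of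
the minimal polynomial of `a` (e.g. `R̃(𝔖(√2)) = R̃(𝔖(−√2))`, all primitive `n`-th roots of
unity give one value). [cite: BurgisserClausenShokrollahi1997, §9.2 Lemma (9.12)] -/
theorem asymptoticRank_fam_eq_of_isConjRoot {a b : ℂ} (ha : IsIntegral ℚ a)
    (hab : IsConjRoot ℚ a b) : asymptoticRank (fam ℂ b) = asymptoticRank (fam ℂ a) := by
  obtain ⟨σ, rfl⟩ := exists_ringEquiv_apply_eq_of_isConjRoot ha hab
  exact asymptoticRank_fam_map σ a

/-- The same, for `b` in the complex root set of `minpoly ℚ a`.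
[cite: BurgisserClausenShokrollahi1997, §9.2 Lemma (9.12)] -/
theorem asymptoticRank_fam_eq_of_mem_rootSet {a b : ℂ} (ha : IsIntegral ℚ a)
    (hb : b ∈ (minpoly ℚ a).rootSet ℂ) : asymptoticRank (fam ℂ b) = asymptoticRank (fam ℂ a) :=
  asymptoticRank_fam_eq_of_isConjRoot ha ((isConjRoot_iff_mem_minpoly_rootSet ha).2 hb)

/-- **Sublevel sets of the line are unions of Galois orbits**: with `a`, every root of
`minpoly ℚ a` lies in `{q | R̃(𝔖(q)) ≤ r}`.
[cite: BurgisserClausenShokrollahi1997, §9.2 Lemma (9.12)] -/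
theorem rootSet_minpoly_subset_level {a : ℂ} (ha : IsIntegral ℚ a) {r : ℝ}
    (har : asymptoticRank (fam ℂ a) ≤ r) :
    (minpoly ℚ a).rootSet ℂ ⊆ {q : ℂ | asymptoticRank (fam ℂ q) ≤ r} := fun b hb => by
  rw [Set.mem_setOf_eq, asymptoticRank_fam_eq_of_mem_rootSet ha hb]
  exact har

/-- The orbit has `[ℚ(a):ℚ]` elements: `#(roots of minpoly ℚ a in ℂ) = deg minpoly ℚ a`
(separability in characteristic `0`). [cite: BurgisserClausenShokrollahi1997, §9.2 Lemma (9.12)] -/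
theorem ncard_rootSet_minpoly {a : ℂ} (ha : IsIntegral ℚ a) :
    ((minpoly ℚ a).rootSet ℂ).ncard = (minpoly ℚ a).natDegree := by
  classical
  rw [← Nat.card_coe_set_eq, Nat.card_eq_fintype_card]
  exact Polynomial.card_rootSet_eq_natDegree
    (PerfectField.separable_of_irreducible (minpoly.irreducible ha)) (IsAlgClosed.splits _)

/-- **Heintz–Sieveking on the line: a special modulus has bounded degree.** If
`R̃(𝔖(a)) ≤ c < R̃(𝔖(q₁))` for some `q₁`, then `[ℚ(a):ℚ] ≤ #{q | R̃(𝔖(q)) ≤ c}` (a finite set,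
`finite_special_fam_below`). [cite: BurgisserClausenShokrollahi1997, §9.2 Theorem (9.15)] -/
theorem natDegree_minpoly_le_ncard {a q₁ : ℂ} (ha : IsIntegral ℚ a) {c : ℝ}
    (hc : c < asymptoticRank (fam ℂ q₁)) (hac : asymptoticRank (fam ℂ a) ≤ c) :
    (minpoly ℚ a).natDegree ≤ {q : ℂ | asymptoticRank (fam ℂ q) ≤ c}.ncard := by
  rw [← ncard_rootSet_minpoly ha]
  exact Set.ncard_le_ncard (rootSet_minpoly_subset_level ha hac) (finite_special_fam_below hc)

/-- **Moduli of large degree are generic below `c`**: if `deg minpoly ℚ a` exceeds the number of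
members with `R̃(𝔖(q)) ≤ c` (`c` short of some attained value), then `c < R̃(𝔖(a))`.
[cite: BurgisserClausenShokrollahi1997, §9.2 Theorem (9.15)] -/
theorem lt_asymptoticRank_fam_of_ncard_lt_natDegree {q₁ : ℂ} {c : ℝ}
    (hc : c < asymptoticRank (fam ℂ q₁)) {a : ℂ}
    (h : {q : ℂ | asymptoticRank (fam ℂ q) ≤ c}.ncard < (minpoly ℚ a).natDegree) :
    c < asymptoticRank (fam ℂ a) := by
  by_contra hle
  have ha : IsIntegral ℚ a := by
    by_contra hna
    rw [minpoly.eq_zero hna, Polynomial.natDegree_zero] at h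
    exact Nat.not_lt_zero _ h
  exact absurd h (not_lt.2 (natDegree_minpoly_le_ncard ha hc (not_lt.1 hle)))

/-- **A degree threshold for genericity below each level**: for every `c` short of an attained
value there is `D` with `c < R̃(𝔖(a))` for all `a` of degree `> D` over `ℚ`.
[cite: BurgisserClausenShokrollahi1997, §9.2 Theorem (9.15)] -/
theorem exists_degree_threshold {q₁ : ℂ} {c : ℝ} (hc : c < asymptoticRank (fam ℂ q₁)) :
    ∃ D : ℕ, ∀ a : ℂ, D < (minpoly ℚ a).natDegree → c < asymptoticRank (fam ℂ a) :=
  ⟨_, fun _ h => lt_asymptoticRank_fam_of_ncard_lt_natDegree hc h⟩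

/-- **The arithmetic of genericity on the line.** Below any level `c < R̃(𝔖(q₁))`: a modulus that
is transcendental, or algebraic of degree exceeding `#{q | R̃(𝔖(q)) ≤ c}`, has `R̃(𝔖(a)) > c`;
the special members below `c` are algebraic numbers of bounded degree.
[cite: ChristandlHoeberechtsNieuwboerVranaZuiddam2025, Theorem 1.2] -/
theorem generic_of_transcendental_or_large_degree {q₁ : ℂ} {c : ℝ}
    (hc : c < asymptoticRank (fam ℂ q₁)) {a : ℂ}
    (h : Transcendental ℤ a ∨
      {q : ℂ | asymptoticRank (fam ℂ q) ≤ c}.ncard < (minpoly ℚ a).natDegree) :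
    c < asymptoticRank (fam ℂ a) := by
  rcases h with h | h
  · exact lt_of_lt_of_le hc (dominant_of_transcendental h q₁)
  · exact lt_asymptoticRank_fam_of_ncard_lt_natDegree hc h

/-- **The special set below `c` consists of algebraic numbers of bounded degree.**
[cite: BurgisserClausenShokrollahi1997, §9.2 Theorem (9.15)] -/
theorem special_subset_bounded_degree {q₁ : ℂ} {c : ℝ} (hc : c < asymptoticRank (fam ℂ q₁)) :
    {q : ℂ | asymptoticRank (fam ℂ q) ≤ c} ⊆
      {q : ℂ | IsIntegral ℚ q ∧
        (minpoly ℚ q).natDegree ≤ {q : ℂ | asymptoticRank (fam ℂ q) ≤ c}.ncard} := by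
  intro a ha
  have hint : IsIntegral ℚ a := by
    by_contra hna
    have ht : Transcendental ℤ a := fun halg => hna ?_
    · exact absurd ha (not_le.2 (lt_of_lt_of_le hc (dominant_of_transcendental ht q₁)))
    · exact (halg.extendScalars (R := ℤ) (S := ℚ)
        (algebraMap ℤ ℚ).injective_int).isIntegral
  exact ⟨hint, natDegree_minpoly_le_ncard hint hc ha⟩

end Orbit

/-! ## 3. Roots of unity: one value per order; large orders are generic below each level -/

section RootsOfUnity

open Polynomial

/-- The minimal polynomial over `ℚ` of a primitive `n`-th root of unity in `ℂ` is `Φₙ`.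
[folklore] -/
theorem minpoly_eq_cyclotomic {ζ : ℂ} {n : ℕ} (hn : 0 < n) (hζ : IsPrimitiveRoot ζ n) :
    minpoly ℚ ζ = cyclotomic n ℚ :=
  (cyclotomic_eq_minpoly_rat hζ hn).symm

/-- A root of unity is integral over `ℚ`. [folklore] -/
theorem isIntegral_of_isPrimitiveRoot {ζ : ℂ} {n : ℕ} (hn : 0 < n) (hζ : IsPrimitiveRoot ζ n) :
    IsIntegral ℚ ζ :=
  IsIntegral.of_pow hn (by rw [hζ.pow_eq_one]; exact isIntegral_one)

/-- Any two primitive `n`-th roots of unity are conjugate over `ℚ`: `ζ'` is a root of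
`minpoly ℚ ζ = Φₙ`. [folklore] -/
theorem mem_rootSet_minpoly_of_isPrimitiveRoot {ζ ζ' : ℂ} {n : ℕ} (hn : 0 < n)
    (hζ : IsPrimitiveRoot ζ n) (hζ' : IsPrimitiveRoot ζ' n) : ζ' ∈ (minpoly ℚ ζ).rootSet ℂ := by
  rw [minpoly_eq_cyclotomic hn hζ, mem_rootSet_of_ne (cyclotomic_ne_zero n ℚ), aeval_def,
    eval₂_eq_eval_map, map_cyclotomic]
  exact hζ'.isRoot_cyclotomic hn

/-- **All primitive `n`-th roots of unity give ONE value `R̃(𝔖(ζ))`** (the `φ(n)` moduli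
`e^{2πik/n}`, `k` coprime to `n`, are `Aut(ℂ)`-conjugate).
[cite: BurgisserClausenShokrollahi1997, §9.2 Lemma (9.12)] -/
theorem asymptoticRank_fam_eq_of_isPrimitiveRoot {ζ ζ' : ℂ} {n : ℕ} (hn : 0 < n)
    (hζ : IsPrimitiveRoot ζ n) (hζ' : IsPrimitiveRoot ζ' n) :
    asymptoticRank (fam ℂ ζ') = asymptoticRank (fam ℂ ζ) :=
  asymptoticRank_fam_eq_of_mem_rootSet (isIntegral_of_isPrimitiveRoot hn hζ)
    (mem_rootSet_minpoly_of_isPrimitiveRoot hn hζ hζ')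

/-- Concretely: `R̃(𝔖(e^{2πik/n})) = R̃(𝔖(e^{2πi/n}))` for `k` coprime to `n`.
[cite: BurgisserClausenShokrollahi1997, §9.2 Lemma (9.12)] -/
theorem asymptoticRank_fam_exp_pow {n k : ℕ} (hn : 0 < n) (hk : k.Coprime n) :
    asymptoticRank (fam ℂ (Complex.exp (2 * Real.pi * Complex.I / n) ^ k)) =
      asymptoticRank (fam ℂ (Complex.exp (2 * Real.pi * Complex.I / n))) :=
  asymptoticRank_fam_eq_of_isPrimitiveRoot hn (Complex.isPrimitiveRoot_exp n hn.ne')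
    ((Complex.isPrimitiveRoot_exp n hn.ne').pow_of_coprime k hk)

/-- **Heintz–Sieveking for roots of unity: a special root of unity has small order**,
`R̃(𝔖(ζ)) ≤ c < R̃(𝔖(q₁))` ⟹ `φ(n) ≤ #{q | R̃(𝔖(q)) ≤ c}`.
[cite: BurgisserClausenShokrollahi1997, §9.2 Theorem (9.15)] -/
theorem totient_le_ncard_of_level_le {ζ q₁ : ℂ} {n : ℕ} (hn : 0 < n) (hζ : IsPrimitiveRoot ζ n)
    {c : ℝ} (hc : c < asymptoticRank (fam ℂ q₁)) (hζc : asymptoticRank (fam ℂ ζ) ≤ c) :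
    n.totient ≤ {q : ℂ | asymptoticRank (fam ℂ q) ≤ c}.ncard := by
  have h := natDegree_minpoly_le_ncard (isIntegral_of_isPrimitiveRoot hn hζ) hc hζc
  rwa [minpoly_eq_cyclotomic hn hζ, natDegree_cyclotomic] at h

/-- **Roots of unity of large order are generic below `c`**: if `#{q | R̃(𝔖(q)) ≤ c} < φ(n)`
then `c < R̃(𝔖(ζ))` for every primitive `n`-th root of unity `ζ`.
[cite: BurgisserClausenShokrollahi1997, §9.2 Theorem (9.15)] -/
theorem lt_asymptoticRank_fam_of_isPrimitiveRoot {q₁ : ℂ} {c : ℝ}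
    (hc : c < asymptoticRank (fam ℂ q₁)) {ζ : ℂ} {n : ℕ} (hn : 0 < n)
    (hζ : IsPrimitiveRoot ζ n) (h : {q : ℂ | asymptoticRank (fam ℂ q) ≤ c}.ncard < n.totient) :
    c < asymptoticRank (fam ℂ ζ) :=
  lt_asymptoticRank_fam_of_ncard_lt_natDegree hc
    (by rwa [minpoly_eq_cyclotomic hn hζ, natDegree_cyclotomic])

/-- In particular for prime orders: `#{q | R̃(𝔖(q)) ≤ c} + 1 < p` ⟹ `c < R̃(𝔖(e^{2πi/p}))` — a
named algebraic family generic below every level short of an attained value.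
[cite: BurgisserClausenShokrollahi1997, §9.2 Theorem (9.15)] -/
theorem lt_asymptoticRank_fam_exp_of_prime {q₁ : ℂ} {c : ℝ}
    (hc : c < asymptoticRank (fam ℂ q₁)) {p : ℕ} (hp : p.Prime)
    (hpc : {q : ℂ | asymptoticRank (fam ℂ q) ≤ c}.ncard + 1 < p) :
    c < asymptoticRank (fam ℂ (Complex.exp (2 * Real.pi * Complex.I / p))) :=
  lt_asymptoticRank_fam_of_isPrimitiveRoot hc hp.pos (Complex.isPrimitiveRoot_exp p hp.ne_zero)
    (by rw [Nat.totient_prime hp]; omega)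

end RootsOfUnity

end Summit.MatrixMultiplication.MatrixMultiplication.Theorems.FarEdgeDescentGaloisOrbit

end
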